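import Summits.AtomisticToContinuum.HydrodynamicLimit.Theorems.OneFlightGossipEngineAssemblyEntropyTransport
import Literature.MathematicalPhysics.KineticTheory.HardSphereEulerProofs
import Mathlib.InformationTheory.KullbackLeibler.Basic
import HarnessLib

/-!
# Crux `RestartPrinciple` (stmt-AtomisticToContinuum-12503), line `isentropic-regibbsification` — line glue

Lead c5. Elementary glue consumed by the line's composition
`restartPrinciple_of_noAnomalousDissipation` (file `RelayRaceLocalityRestartPrincipleOfNoAnomalousDissipation`):

* measure theory along a hard-sphere flow for Liouville-absolutely-continuous laws: `localGibbsLaw_ac`,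
  `lawAt_ac`, finiteness / probability of `lawAt`, `lawAt_zero` (`Φ_0 = id` a.e.), the group property in law
  `lawAt_eq_lawAt_lawAt`, transport of relative entropy `klDiv_lawAt_lawAt`, and the invisibility of the
  junk values of `Φ_0` off the good set (`measure_setOf_flow_zero_eq`);
* limits: the relay step in the limit `tendsto_zero_of_relay` (`h₁ ≤ (1+γ⁻¹)h₀ + D_γ`, `h₀ = o(N)`,
  `D_γ ≤ ε(N+1)` eventually for some `γ = γ(ε)` ⟹ `h₁ = o(N)`) and `tendsto_integral_of_tendsto_measure_gt`
  (uniformly bounded observables that converge in probability converge in mean; `C e^{-(N+1)/C} → 0` is the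
  tree's `LGFS.tendsto_ofReal_Kexp`).

These are the sorry-free glue lemmas of the planner's skeleton `Lines/isentropic_regibbsification.lean` (v3),
moved under `Theorems/` so that the reduction of the crux to the single registered stub
`stub_noAnomalousDissipation` is importable. No definitions, no named facts.
-/

noncomputable section

open Literature.MathematicalPhysics.KineticTheory Literature.Analysis.FluidPDE
open MeasureTheory Filter Set Topology InformationTheory
open scoped ENNReal

namespace Summit.AtomisticToContinuum.HydrodynamicLimit.Theorems.RestartPrinciple.IsentropicRegibbsification

/-! ## Measure theory along the flow -/

section FlowGlue

variable {σ : ℝ} {N : ℕ}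

/-- Local Gibbs laws are absolutely continuous with respect to the Liouville measure. [folklore] -/
theorem localGibbsLaw_ac (σ : ℝ) (a θ : T3 → ℝ) (u : T3 → V3) (N : ℕ)
    (Φ : HardSphereFlow (Torus.geometry (Fin 3)) (hsDiameter σ N) (N + 1)) :
    localGibbsLaw σ a u θ N Φ ≪ liouville (Torus.geometry (Fin 3)) (N + 1) (hsDiameter σ N) := by
  unfold localGibbsLaw particleLaw
  exact withDensity_absolutelyContinuous _ _

variable (Φ : HardSphereFlow (Torus.geometry (Fin 3)) (hsDiameter σ N) (N + 1))

/-- The law at time `r` of a Liouville-a.c. law is Liouville-a.c. (Liouville invariance). [folklore] -/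
theorem lawAt_ac {ν : Measure (Config (N + 1) (Fin 3) T3)}
    (hν : ν ≪ liouville (Torus.geometry (Fin 3)) (N + 1) (hsDiameter σ N)) (r : ℝ) :
    Φ.lawAt ν r ≪ liouville (Torus.geometry (Fin 3)) (N + 1) (hsDiameter σ N) := by
  rw [HardSphereFlow.lawAt_eq]
  have h := hν.map (Φ.measurable_flow r)
  rwa [(Φ.measurePreserving r).map_eq] at h

/-- `lawAt` of a finite measure is finite. [folklore] -/
theorem isFiniteMeasure_lawAt (ν : Measure (Config (N + 1) (Fin 3) T3)) [IsFiniteMeasure ν] (r : ℝ) :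
    IsFiniteMeasure (Φ.lawAt ν r) := by
  rw [HardSphereFlow.lawAt_eq]; infer_instance

/-- `lawAt` of a probability measure is a probability measure. [folklore] -/
theorem isProbabilityMeasure_lawAt (ν : Measure (Config (N + 1) (Fin 3) T3)) [IsProbabilityMeasure ν]
    (r : ℝ) : IsProbabilityMeasure (Φ.lawAt ν r) := by
  rw [HardSphereFlow.lawAt_eq]
  exact Measure.isProbabilityMeasure_map (Φ.measurable_flow r).aemeasurable

/-- At time `0` the law is the initial law (`Φ_0 = id` on the conull good set). [folklore] -/
theorem lawAt_zero {ν : Measure (Config (N + 1) (Fin 3) T3)}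
    (hν : ν ≪ liouville (Torus.geometry (Fin 3)) (N + 1) (hsDiameter σ N)) : Φ.lawAt ν 0 = ν := by
  rw [HardSphereFlow.lawAt_eq]
  have hae : (Φ.flow 0) =ᵐ[ν] id := by
    filter_upwards [hardSphereFlow_ae_mem_good_of_absolutelyContinuous Φ hν] with z hz
    exact Φ.flow_zero z hz
  rw [Measure.map_congr hae, Measure.map_id]

/-- The junk values of `Φ_0` off the good set are invisible to a Liouville-a.c. law: the event
"`p` holds at `Φ_0 z`" has the same mass as "`p` holds at `z`". [folklore] -/
theorem measure_setOf_flow_zero_eq {ν : Measure (Config (N + 1) (Fin 3) T3)}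
    (hν : ν ≪ liouville (Torus.geometry (Fin 3)) (N + 1) (hsDiameter σ N))
    (p : Config (N + 1) (Fin 3) T3 → Prop) : ν {z | p (Φ.flow 0 z)} = ν {z | p z} := by
  refine measure_congr (Filter.eventuallyEq_set.2 ?_)
  filter_upwards [hardSphereFlow_ae_mem_good_of_absolutelyContinuous Φ hν] with z hz
  simp only [Φ.flow_zero z hz]

/-- Group property in law: `(Φ_t)_# ν = (Φ_{t-s})_# (Φ_s)_# ν` for Liouville-a.c. `ν`. [folklore] -/
theorem lawAt_eq_lawAt_lawAt {ν : Measure (Config (N + 1) (Fin 3) T3)}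
    (hν : ν ≪ liouville (Torus.geometry (Fin 3)) (N + 1) (hsDiameter σ N)) (s t : ℝ) :
    Φ.lawAt ν t = Φ.lawAt (Φ.lawAt ν s) (t - s) := by
  simp only [HardSphereFlow.lawAt_eq]
  rw [Measure.map_map (Φ.measurable_flow (t - s)) (Φ.measurable_flow s)]
  refine Measure.map_congr ?_
  filter_upwards [hardSphereFlow_ae_mem_good_of_absolutelyContinuous Φ hν] with z hz
  show Φ.flow t z = Φ.flow (t - s) (Φ.flow s z)
  rw [← Φ.flow_add (t - s) s z hz, sub_add_cancel]

/-- Relative entropy is transported along the flow: `KL((Φ_r)_# μ ‖ (Φ_r)_# ν) = KL(μ ‖ ν)`.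
[cite: OllaVaradhanYau1993, §3] -/
theorem klDiv_lawAt_lawAt (μ ν : Measure (Config (N + 1) (Fin 3) T3)) [IsFiniteMeasure μ]
    [IsFiniteMeasure ν] (hμ : μ ≪ liouville (Torus.geometry (Fin 3)) (N + 1) (hsDiameter σ N))
    (hν : ν ≪ liouville (Torus.geometry (Fin 3)) (N + 1) (hsDiameter σ N)) (r : ℝ) :
    klDiv (Φ.lawAt μ r) (Φ.lawAt ν r) = klDiv μ ν := by
  haveI : IsFiniteMeasure (Φ.lawAt ν r) := isFiniteMeasure_lawAt Φ ν r
  rw [klDiv_lawAt_eq Φ μ (Φ.lawAt ν r) hμ (lawAt_ac Φ hν r) r]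
  congr 1
  rw [HardSphereFlow.lawAt_eq]
  simpa only [neg_neg] using hardSphereFlow_map_flow_neg_map_flow Φ ν hν (-r)

end FlowGlue

/-! ## Limits -/

/-- The relay step in the limit: if `h₁ ≤ (1 + γ⁻¹) h₀ + D_γ` for every `γ > 0`, `h₀ / (N+1) → 0`, and for
every `ε > 0` some `γ > 0` has `D_γ ≤ ε (N+1)` eventually, then `h₁ / (N+1) → 0`. [folklore] -/
theorem tendsto_zero_of_relay (h₀ h₁ : ℕ → ℝ≥0∞) (D : ℝ → ℕ → ℝ≥0∞)
    (hrelay : ∀ γ : ℝ, 0 < γ → ∀ N, h₁ N ≤ ENNReal.ofReal (1 + γ⁻¹) * h₀ N + D γ N)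
    (hlim : Tendsto (fun N : ℕ => h₀ N / ((N : ℝ≥0∞) + 1)) atTop (𝓝 0))
    (hD : ∀ ε : ℝ, 0 < ε → ∃ γ : ℝ, 0 < γ ∧ ∀ᶠ N : ℕ in atTop,
      D γ N ≤ ENNReal.ofReal ε * ((N : ℝ≥0∞) + 1)) :
    Tendsto (fun N : ℕ => h₁ N / ((N : ℝ≥0∞) + 1)) atTop (𝓝 0) := by
  rw [ENNReal.tendsto_nhds_zero]
  intro ε hε
  by_cases htop : ε = ∞
  · exact Eventually.of_forall fun N => htop ▸ le_top
  have hεr : 0 < ε.toReal := ENNReal.toReal_pos hε.ne' htop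
  set δ : ℝ := ε.toReal / 2 with hδ
  have hδpos : 0 < δ := by positivity
  obtain ⟨γ, hγ, hDγ⟩ := hD δ hδpos
  have hc : 0 < 1 + γ⁻¹ := by positivity
  have h0ev : ∀ᶠ N : ℕ in atTop, h₀ N / ((N : ℝ≥0∞) + 1) ≤ ENNReal.ofReal (δ / (1 + γ⁻¹)) := by
    rw [ENNReal.tendsto_nhds_zero] at hlim
    exact hlim _ (ENNReal.ofReal_pos.2 (by positivity))
  filter_upwards [hDγ, h0ev] with N hDN h0N
  have hN0 : ((N : ℝ≥0∞) + 1) ≠ 0 := by positivity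
  have hNtop : ((N : ℝ≥0∞) + 1) ≠ ∞ := by simp
  have h0N' : h₀ N ≤ ENNReal.ofReal (δ / (1 + γ⁻¹)) * ((N : ℝ≥0∞) + 1) :=
    (ENNReal.div_le_iff_le_mul (Or.inl hN0) (Or.inl hNtop)).1 h0N
  have h1 : ENNReal.ofReal (1 + γ⁻¹) * h₀ N ≤ ENNReal.ofReal δ * ((N : ℝ≥0∞) + 1) := by
    calc ENNReal.ofReal (1 + γ⁻¹) * h₀ N
        ≤ ENNReal.ofReal (1 + γ⁻¹) * (ENNReal.ofReal (δ / (1 + γ⁻¹)) * ((N : ℝ≥0∞) + 1)) := by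
          gcongr
      _ = ENNReal.ofReal δ * ((N : ℝ≥0∞) + 1) := by
          rw [← mul_assoc, ← ENNReal.ofReal_mul hc.le, mul_div_cancel₀ _ hc.ne']
  have hsum : h₁ N ≤ ε * ((N : ℝ≥0∞) + 1) := by
    calc h₁ N ≤ ENNReal.ofReal (1 + γ⁻¹) * h₀ N + D γ N := hrelay γ hγ N
      _ ≤ ENNReal.ofReal δ * ((N : ℝ≥0∞) + 1) + ENNReal.ofReal δ * ((N : ℝ≥0∞) + 1) :=
          add_le_add h1 hDN
      _ = ENNReal.ofReal (δ + δ) * ((N : ℝ≥0∞) + 1) := by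
          rw [ENNReal.ofReal_add hδpos.le hδpos.le, add_mul]
      _ = ε * ((N : ℝ≥0∞) + 1) := by
          rw [show δ + δ = ε.toReal by rw [hδ]; ring, ENNReal.ofReal_toReal htop]
  exact (ENNReal.div_le_iff_le_mul (Or.inl hN0) (Or.inl hNtop)).2 hsum

/-- **Uniformly bounded observables that converge in probability converge in mean**: for probability
measures `μ_N`, measurable `X_N` with `|X_N| ≤ B`, and `μ_N{δ < |X_N − c|} → 0` for every `δ > 0`,
`∫ X_N dμ_N → c`. [folklore] -/
theorem tendsto_integral_of_tendsto_measure_gt {Ω : ℕ → Type*} [∀ N, MeasurableSpace (Ω N)]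
    (μ : ∀ N, Measure (Ω N)) [hμ : ∀ N, IsProbabilityMeasure (μ N)] (X : ∀ N, Ω N → ℝ) (c B : ℝ)
    (hXm : ∀ N, Measurable (X N)) (hB : ∀ N z, |X N z| ≤ B)
    (h : ∀ δ : ℝ, 0 < δ → Tendsto (fun N => μ N {z | δ < |X N z - c|}) atTop (𝓝 0)) :
    Tendsto (fun N => ∫ z, X N z ∂μ N) atTop (𝓝 c) := by
  rw [Metric.tendsto_atTop]
  intro ε hε
  -- the constant `K` bounding `|X − c|` and the two small parameters
  set K : ℝ := |B| + |c| with hK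
  have hK0 : 0 ≤ K := by positivity
  set δ : ℝ := ε / 3 with hδ
  have hδ0 : 0 < δ := by positivity
  set r : ℝ := ε / (3 * (K + 1)) with hr
  have hr0 : 0 < r := by positivity
  have hr1 : r * (K + 1) = ε / 3 := by rw [hr]; field_simp
  have hev : ∀ᶠ N in atTop, μ N {z | δ < |X N z - c|} ≤ ENNReal.ofReal r := by
    have := h δ hδ0
    rw [ENNReal.tendsto_nhds_zero] at this
    exact this _ (ENNReal.ofReal_pos.2 hr0)
  obtain ⟨N₀, hN₀⟩ := eventually_atTop.1 hev
  refine ⟨N₀, fun N hN => ?_⟩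
  have hAm : MeasurableSet {z | δ < |X N z - c|} :=
    measurableSet_lt measurable_const (continuous_abs.measurable.comp ((hXm N).sub_const c))
  have hμA : (μ N).real {z | δ < |X N z - c|} ≤ r :=
    ENNReal.toReal_le_of_le_ofReal hr0.le (hN₀ N hN)
  -- pointwise: `|X − c| ≤ δ + K · 𝟙_A`
  have hpt : ∀ z, |X N z - c| ≤ δ + K * {z | δ < |X N z - c|}.indicator (fun _ => (1 : ℝ)) z := by
    intro z
    by_cases hz : z ∈ {z | δ < |X N z - c|}
    · rw [indicator_of_mem hz, mul_one]
      calc |X N z - c| ≤ |X N z| + |c| := abs_sub _ _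
        _ ≤ |B| + |c| := by linarith [hB N z, le_abs_self B]
        _ ≤ δ + K := by rw [hK]; linarith
    · rw [indicator_of_notMem hz, mul_zero, add_zero]
      exact not_lt.1 hz
  -- integrate
  have hXi : Integrable (X N) (μ N) :=
    Integrable.of_bound (hXm N).aestronglyMeasurable B (ae_of_all _ fun z => by
      rw [Real.norm_eq_abs]; exact hB N z)
  have hIi : Integrable ({z | δ < |X N z - c|}.indicator fun _ => (1 : ℝ)) (μ N) :=
    (integrable_const 1).indicator hAm
  have hI1 : ∫ z, {z | δ < |X N z - c|}.indicator (fun _ => (1 : ℝ)) z ∂μ N =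
      (μ N).real {z | δ < |X N z - c|} := by
    rw [integral_indicator_const _ hAm, smul_eq_mul, mul_one]
  have hIrhs : ∫ z, δ + K * {z | δ < |X N z - c|}.indicator (fun _ => (1 : ℝ)) z ∂μ N =
      δ + K * (μ N).real {z | δ < |X N z - c|} := by
    rw [integral_add (integrable_const δ) (hIi.const_mul K), integral_const, probReal_univ, one_smul,
      integral_const_mul, hI1]
  have hint : ∫ z, |X N z - c| ∂μ N ≤ δ + K * (μ N).real {z | δ < |X N z - c|} := by
    rw [← hIrhs]
    exact integral_mono (hXi.sub (integrable_const c)).abs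
      ((integrable_const δ).add (hIi.const_mul K)) hpt
  have hdist : dist (∫ z, X N z ∂μ N) c = |∫ z, X N z - c ∂μ N| := by
    rw [Real.dist_eq, integral_sub hXi (integrable_const c), integral_const, probReal_univ, one_smul]
  rw [hdist]
  have hKr : K * r ≤ ε / 3 := by nlinarith [hr1, hr0.le, hK0]
  calc |∫ z, X N z - c ∂μ N| ≤ ∫ z, |X N z - c| ∂μ N := abs_integral_le_integral_abs
    _ ≤ δ + K * (μ N).real {z | δ < |X N z - c|} := hint
    _ ≤ δ + K * r := by gcongr
    _ ≤ ε / 3 + ε / 3 := by rw [hδ]; linarith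
    _ < ε := by linarith

end Summit.AtomisticToContinuum.HydrodynamicLimit.Theorems.RestartPrinciple.IsentropicRegibbsification

end
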